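import Summits.BirchSwinnertonDyer.BirchSwinnertonDyer.Theses.KimAtThreeKolyvagin
import Summits.BirchSwinnertonDyer.Rank1Residual.GaloisImage.KatoKuriharaPortThreeOfZetaBodyOfValueRows
import Summits.BirchSwinnertonDyer.Rank1Residual.GaloisImage.LocalThreeTorsionAdicCompletion
import Literature.NumberTheory.EllipticCurves.BSDRootNumberLocalTablesProofs
import Literature.NumberTheory.EllipticCurves.RootNumberProofs
import Literature.NumberTheory.EllipticCurves.TateModuleContinuityProofs
import Literature.NumberTheory.EllipticCurves.TateModuleFreeProofs
import Literature.NumberTheory.EllipticCurves.TorsionFrobeniusProofs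
import HarnessLib

/-!
# Crux `KatoKuriharaPortThreeShared` (stmt-BirchSwinnertonDyer-19560) BY NAME from Kato's Euler
# system: the shared-generator PORT″ at `t = 0` reduced to THREE displayed residual inputs
# (cell `bsd-addord`, seat kim3 gen 10; route W2 `KimAtThreeKolyvagin`, §U child of 19076)

The crux `KatoKuriharaPortThreeShared` (the Kato–Kurihara dictionary PORT″
`KatoKuriharaPortThreeAtWith₂ W 0 v₃ η P` for every tower-surjective `W` additive at `3` with
`3 ∤ c₃`, `E(ℚ₃)[3] = 0`, at a lattice-optimal parametrisation datum `P` of conductor level with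
`3 ∤` Manin constant) is the "declared PORT" of the Kato stratum of the W2 cruxes 19075/19076.  The
n1011 cell's END theorem ★ PK-6₂ ∘ T-PK6-VDIS
(`GaloisImage.katoKuriharaPortThreeAtWith₂_zero_of_zetaBody_of_valueRows`) derives PORT″ at ONE row
from (a) Kato's cited matrix `ZetaBody` for the newform `P.f` (the conclusion of the tree's PUBLISHED
named fact `Kato2004.exists_eulerSystem_expStar_values`: Kato, Astérisque 295, (8.1.3)/Ex. 13.3,
Prop. 8.12, Thm. 9.7, Thm. 6.6 (1)), (b) the CONSTRUCTION-SHAPED finite-level dual-exponential riders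
`KatoExpStarFiniteLevelAt W 3 j 0 v₃ Λ (Λfin j)` for the SAME value datum `Λ` together with the
`ω`-coordinate normalisation `hNorm` of Kato's constant (kim3 memo KIM3-PROOF §4.2 Lemma L / L′,
§4.4 (a″); in print Kim–Nakamura 2020 Cor. 2.4 / Kim 2022 Prop. 3.12 at a good prime — NOT
derivable from the abstract fact, whose witnesses are defined up to a scalar), (c) per-row VALUE
CERTIFICATES on Kato's auxiliary cusp datum `(c, d, a, A)` (Euler factors at `q ∣ 3A` and the
four-term minus-symbol factor `R⁻` are `3`-units, the datum avoids primes `≡ 1 (mod 3)`), and (d)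
THEOREM D's row certificates `ht0` (`t = 0`) and `hbad` (no non-zero `3`-torsion over `ℚ_w` at a
bad place `w ≠ 3`).

THIS FILE (theorems only; no definition, no named fact, no `sorry`) proves the crux BY NAME from
three DISPLAYED inputs, each quantified over the crux's own binders, and discharges every other
binder of ★ PK-6₂ from the crux's hypotheses:
* `ht0` from `#E(ℚ₃)[3] = 1` (transport `ℚ_[3] ≃ ℚ_v` of the tree,
  `LocalTorsion3.natCard_ker_nsmul_adicCompletion_eq_natCard_torsion_padic`);
* `hpN : 9 ∣ N` from `Addv W 3` and `N = N_W` (Silverman ATAEC IV.10.2 (c),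
  `natGenerator_sq_dvd_conductorNorm_iff`);
* `hirr` from the tower (surjective mod `3` ⟹ `E[3]` irreducible);
* the Tate-module instance binders from the tree's `_holds` theorems.
The three displayed inputs (= the EXACT residual of 19560 over the tree; kim3 memo
`HOME/kim3/KIM3-W2-PORT-g10.md`):
* (C1) FINE KATO PACKAGE — for every row, SOME Kato witnesses `(ι, κ, Λ)` of the `ZetaBody` family
  (all admissible `(c, d, a, A)`) admit finite-level functionals `Λfin j` with
  `KatoExpStarFiniteLevelAt` at every depth and have `κ ∈ ℚ`, `v₃(κ) = 0`.  Its projection is the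
  conclusion of Kato's published fact on these rows; the surplus is memo Lemma L/L′ + SAT + (a″).
* (C2) CERTIFICATE SUPPLY — for every row, SOME auxiliary datum `(c, d, a, A, d′, aM)` meets
  Kato's guards and the value certificates (memo §R2: reduces to the non-vanishing mod `3` of the
  minus modular symbol of `P.f` on denominators `q^n`, `q ≡ 2 (mod 3)` non-anomalous — a per-row
  decidable certificate; class-wide it is an Ash–Stevens / Vatsal-type statement, not in the tree).
* (C3) ANOMALOUS ROWS — the crux itself on the rows having a bad place `w ≠ 3` with
  `E(ℚ_w)[3] ≠ 0` (THEOREM D's `hbad`; in print these rows are covered by Rubin, *Euler Systems*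
  Thm. 4.5.1 via universal norms in the cyclotomic direction — the tree's derivative machinery is
  tame-level only, so they stay displayed; n1011's END-b serves them on thinned data only).
Also recorded: the non-anomalous rows from (C1) + (C2) alone.

HONEST LIMITS: closes nothing by itself (crux 19560 stays OPEN: C1 is construction-shaped over the
tree, C2 is open class-wide, C3 is open in the kernel); nothing is booked; no mark moves.
References: [Kato2004Asterisque] §8.1, Prop. 8.12, §9.4, Thm. 9.7, Thm. 6.6 (1), Ex. 13.3;
[Kim2022StructureSelmer] Thm. 3.13, §3.3; [KimNakamura2020] Cor. 2.4; [MazurRubin2004] Thm. 3.2.4,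
App. A; [Rubin2000] Thm. 4.5.1; kim3 memo KIM3-PROOF v2.5 §4; KIM3-W2-PORT-g10.md.
-/

noncomputable section

set_option linter.dupNamespace false

open scoped NumberField TensorProduct Classical
open Field Finset IsDedekindDomain NumberField WeierstrassCurve Rat.HeightOneSpectrum
open Literature.NumberTheory.GaloisRepresentations Literature.NumberTheory.GaloisCohomology
open Literature.NumberTheory.GaloisRepresentations.DiscreteGaloisModule
open Literature.NumberTheory.EllipticCurves Literature.NumberTheory.EllipticCurves.ModularForms
open Literature.NumberTheory.EllipticCurves.Rank1Residual
open Literature.NumberTheory.EllipticCurves.Kato2004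
open Literature.NumberTheory.EllipticCurves.Kato2004.EulerSystemValues
open Summit.BirchSwinnertonDyer.Rank1Residual.GaloisImage

namespace Summit.BirchSwinnertonDyer.BirchSwinnertonDyer.Theorems.KimAtThreeKolyvaginPortShared

/-! ### §1. Binders of ★ PK-6₂ discharged from the crux's hypotheses -/

/-- **`9 ∣ N_W` at an additive `3`**: `Addv W 3` (neither good nor multiplicative at `3`) is
additive reduction at the place of `ℤ` over `3` by the local trichotomy (Silverman AEC VII.5.1)
and the prime/place bridges of the tree, and `f_v ≥ 2` there (Silverman ATAEC IV.10.2 (c),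
`natGenerator_sq_dvd_conductorNorm_iff`). [cite: Silverman1994, IV.10.2(c)]
[cite: SilvermanAEC2009, VII.5 Prop. 5.1] -/
theorem sq_dvd_conductorNorm_of_addv (W : WeierstrassCurve ℚ) [W.IsElliptic]
    (hadd : haveI : Fact (Nat.Prime 3) := ⟨Nat.prime_three⟩; Addv W 3) :
    3 ^ 2 ∣ W.conductorNorm ℤ := by
  haveI : Fact (Nat.Prime 3) := ⟨Nat.prime_three⟩
  set vZ : HeightOneSpectrum ℤ := (primesEquiv (R := ℤ)).symm ⟨3, Nat.prime_three⟩ with hvZ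
  have hgen : natGenerator vZ = 3 := by
    change ((primesEquiv vZ : Nat.Primes) : ℕ) = 3
    rw [hvZ, Equiv.apply_symm_apply]
  have hng : ¬ W.HasGoodReductionAt vZ := fun h ↦
    hadd.1 ((W.hasGoodReductionAtPrime_iff_hasGoodReductionAt_holds ⟨3, Nat.prime_three⟩).mpr h)
  have hnm : ¬ W.HasMultiplicativeReductionAt vZ := fun h ↦
    hadd.2 ((hasMultiplicativeReductionAtPrime_iff_hasMultiplicativeReductionAt_holds W
      ⟨3, Nat.prime_three⟩).mpr h)
  have haddZ : W.HasAdditiveReductionAt vZ := by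
    rcases W.hasGoodReductionAt_or_hasMultiplicativeReductionAt_or_hasAdditiveReductionAt vZ with
      h | h | h
    · exact absurd h hng
    · exact absurd h hnm
    · exact h
  have h := (natGenerator_sq_dvd_conductorNorm_iff vZ W).mpr haddZ
  rwa [hgen] at h

/-- **THEOREM D's certificate `ht0` from the crux's `t = 0`**: if `#E(ℚ₃)[3] = 1` (the crux's
`Nat.card`-currency over `ℚ_[3]`) then at every place `w` of `𝓞 ℚ` containing `3` every
`3`-torsion point of `E(ℚ_w)` is zero — transport of points along Mathlib's
`adicCompletion.padicEquiv` (tree: `LocalTorsion3.natCard_ker_nsmul_adicCompletion_eq_natCard_torsion_padic`).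
[folklore] -/
theorem forall_torsion_three_eq_zero_adicCompletion_of_natCard_eq_one (W : WeierstrassCurve ℚ)
    (ht : Nat.card {Q : (W.baseChange ℚ_[3]).toAffine.Point // (3 : ℕ) • Q = 0} = 1)
    (w : HeightOneSpectrum (𝓞 ℚ)) (hw : ((3 : ℕ) : 𝓞 ℚ) ∈ w.asIdeal) :
    ∀ Q : (W.baseChange (w.adicCompletion ℚ)).toAffine.Point, 3 • Q = 0 → Q = 0 := by
  have hw3 : ((primesEquiv w : Nat.Primes) : ℕ) = 3 := primesEquiv_eq_of_natCast_mem Nat.prime_three hw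
  have hker := LocalTorsion3.natCard_ker_nsmul_adicCompletion_eq_natCard_torsion_padic W w hw3 3
  rw [ht] at hker
  have hbot := (AddSubgroup.card_eq_one).mp hker
  intro Q hQ
  have hmem : Q ∈ (nsmulAddMonoidHom 3 : (W.baseChange (w.adicCompletion ℚ)).toAffine.Point →+
      (W.baseChange (w.adicCompletion ℚ)).toAffine.Point).ker := by
    rw [AddMonoidHom.mem_ker, nsmulAddMonoidHom_apply]
    exact hQ
  rw [hbot] at hmem
  exact (AddSubgroup.mem_bot).mp hmem

/-- **`E[3]` irreducible under the `3`-adic tower** (surjectivity mod `3` suffices; tree theorem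
`hasIrreducibleModPGaloisRep_of_hasSurjectiveModNGaloisRep`, Serre 1972 §4). [folklore] -/
theorem hasIrreducibleModPGaloisRep_three_of_tower (W : WeierstrassCurve ℚ) [W.IsElliptic]
    (htow : ∀ m : ℕ, W.HasSurjectiveModNGaloisRep (3 ^ m : ℕ)) :
    W.HasIrreducibleModPGaloisRep 3 := by
  haveI : Fact (Nat.Prime 3) := ⟨Nat.prime_three⟩
  exact hasIrreducibleModPGaloisRep_of_hasSurjectiveModNGaloisRep W 3 (by simpa using htow 1)

/-! ### §2. The crux on the rows WITHOUT an anomalous bad place, from (C1) + (C2) -/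

/-- **PORT″ at a row without anomalous bad place `w ≠ 3`, from the FINE KATO PACKAGE (C1) and the
CERTIFICATE SUPPLY (C2)** — every binder of the crux `KatoKuriharaPortThreeShared` VERBATIM, plus
the row hypothesis "no bad `w ≠ 3` carries a non-zero `3`-torsion point over `ℚ_w`" (THEOREM D's
`hbad`), gives `KatoKuriharaPortThreeAtWith₂ W 0 v₃ η P` by ★ PK-6₂ ∘ T-PK6-VDIS with `ht0`,
`hpN`, `hirr` and the Tate-module instance binders discharged here.  (C1)/(C2) are displayed,
crux-sized (module docstring); nothing is booked.
[cite: Kato2004Asterisque, (8.1.3) (p. 180), Prop. 8.12 (p. 186), §9.4 and Thm. 9.7 (pp. 188–189), Thm. 6.6 (1) (p. 163), Ex. 13.3 (pp. 224–225)]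
[cite: Kim2022StructureSelmer, Thm. 3.13 and §3.3–§3.4.1] [cite: MazurRubin2004, Thm. 3.2.4 and App. A] -/
theorem portShared_row_of_fineKato_of_certSupply_of_noAnomalous
    (hC1 : ∀ (W : WeierstrassCurve ℚ) [W.IsElliptic] [W.IsGloballyMinimal]
      [ContinuousSMul ℤ_[3] (W.tateModule 3)] [Module.Free ℤ_[3] (W.tateModule 3)]
      [Module.Finite ℤ_[3] (W.tateModule 3)],
      (∀ m : ℕ, W.HasSurjectiveModNGaloisRep (3 ^ m : ℕ)) →
      (haveI : Fact (Nat.Prime 3) := ⟨Nat.prime_three⟩; Addv W 3) →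
      ¬ 3 ∣ (W.baseChange ℚ_[3]).localTamagawaNumber ℤ_[3] →
      Nat.card {Q : (W.baseChange ℚ_[3]).toAffine.Point // (3 : ℕ) • Q = 0} = 1 →
      ∀ (v₃ : HeightOneSpectrum (𝓞 ℚ)), ((3 : ℕ) : 𝓞 ℚ) ∈ v₃.asIdeal →
      ∀ {N : ℕ} [NeZero N] (P : ModularParametrizationData W N), N = W.conductorNorm ℤ →
        (∀ z ∈ P.L.lattice, ∃ w ∈ periodLattice P.f, z = P.c * w) →
        ¬ (3 : ℤ) ∣ P.maninConstant →
        ∃ (ι : (n : ℕ) → (CyclotomicField n ℚ →+* ℂ)) (κK : ℝ)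
          (Λ : ∀ (k' : ℕ) (r : Finset (HeightOneSpectrum (𝓞 ℚ))),
            H1 (tateRep W 3) (cycSubgroup 3 k' r) →ₗ[ℤ_[3]]
              ℚ_[3] ⊗[ℚ] CyclotomicField (cycLevel 3 k' r) ℚ)
          (Λfin : ∀ j : ℕ, galoisCohomology
            ((W.torsionGaloisModule (((3 : ℕ) : ℤ) ^ j * ((3 : ℕ) : ℤ))).toLocal (Sum.inr v₃)) 1 →+
              ZMod (3 ^ (j + 1))),
          κK ≠ 0 ∧ (∃ u : ℚ, (u : ℝ) = κK ∧ padicValRat 3 u = 0) ∧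
          (∀ j : ℕ, KatoExpStarFiniteLevelAt W 3 j 0 v₃ Λ (Λfin j)) ∧
          ∀ (c d a : ℤ) (A : ℕ), 0 < A → Int.gcd c (6 * 3 * A) = 1 → Int.gcd d (6 * 3 * N) = 1 →
            ∃ (z : ∀ (k' : ℕ) (r : (cyclotomicLevelsRat 3 (badPlaces c d A N)).Ideals),
                  H1 (tateRep W 3) ((cyclotomicLevelsRat 3 (badPlaces c d A N)).level k' r.1))
              (x : ∀ (k' : ℕ) (r : (cyclotomicLevelsRat 3 (badPlaces c d A N)).Ideals),
                  CyclotomicField (cycLevel 3 k' r.1) ℚ),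
              ZetaBody W 3 P.f ι κK Λ c d a A z x)
    (hC2 : ∀ (W : WeierstrassCurve ℚ) [W.IsElliptic] [W.IsGloballyMinimal],
      (∀ m : ℕ, W.HasSurjectiveModNGaloisRep (3 ^ m : ℕ)) →
      (haveI : Fact (Nat.Prime 3) := ⟨Nat.prime_three⟩; Addv W 3) →
      ¬ 3 ∣ (W.baseChange ℚ_[3]).localTamagawaNumber ℤ_[3] →
      Nat.card {Q : (W.baseChange ℚ_[3]).toAffine.Point // (3 : ℕ) • Q = 0} = 1 →
      ∀ {N : ℕ} [NeZero N] (P : ModularParametrizationData W N), N = W.conductorNorm ℤ →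
        (∀ z ∈ P.L.lattice, ∃ w ∈ periodLattice P.f, z = P.c * w) →
        ¬ (3 : ℤ) ∣ P.maninConstant →
        ∃ (c d a : ℤ) (A : ℕ) (d' : ℤ) (aM : ℕ → ℤ),
          0 < A ∧ Int.gcd c (6 * 3 * A) = 1 ∧ Int.gcd d (6 * 3 * N) = 1 ∧
          (∀ q : ℕ, q.Prime → q ≡ 1 [MOD 3] → ¬ q ∣ 2 * c.natAbs * d.natAbs * A) ∧
          Int.gcd (c * d) A = 1 ∧ d * d' ≡ 1 [ZMOD (A : ℤ)] ∧ Nat.Coprime A N ∧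
          (∀ q ∈ (3 * A).primeFactors, cuspCoeff P.f q = aM q) ∧
          (∏ q ∈ (3 * A).primeFactors,
              (1 - (aM q : ℚ) / q + (if q ∣ N then 0 else (1 / q : ℚ))) ≠ 0) ∧
          padicValRat 3 (∏ q ∈ (3 * A).primeFactors,
              (1 - (aM q : ℚ) / q + (if q ∣ N then 0 else (1 / q : ℚ)))) = 0 ∧
          ((c : ℚ) ^ 2 * (d : ℚ) ^ 2 * ratMinusSymbol P.f ((a : ℚ) / A) -
              (c : ℚ) * (d : ℚ) ^ 2 * ratMinusSymbol P.f ((a * c : ℚ) / A) -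
              (c : ℚ) ^ 2 * (d : ℚ) * ratMinusSymbol P.f ((a * d' : ℚ) / A) +
              (c : ℚ) * (d : ℚ) * ratMinusSymbol P.f ((a * c * d' : ℚ) / A) ≠ 0) ∧
          padicValRat 3 ((c : ℚ) ^ 2 * (d : ℚ) ^ 2 * ratMinusSymbol P.f ((a : ℚ) / A) -
              (c : ℚ) * (d : ℚ) ^ 2 * ratMinusSymbol P.f ((a * c : ℚ) / A) -
              (c : ℚ) ^ 2 * (d : ℚ) * ratMinusSymbol P.f ((a * d' : ℚ) / A) +
              (c : ℚ) * (d : ℚ) * ratMinusSymbol P.f ((a * c * d' : ℚ) / A)) = 0)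
    (W : WeierstrassCurve ℚ) [W.IsElliptic] [W.IsGloballyMinimal]
    (htow : ∀ m : ℕ, W.HasSurjectiveModNGaloisRep (3 ^ m : ℕ))
    (hadd : haveI : Fact (Nat.Prime 3) := ⟨Nat.prime_three⟩; Addv W 3)
    (hc3 : ¬ 3 ∣ (W.baseChange ℚ_[3]).localTamagawaNumber ℤ_[3])
    (ht : Nat.card {Q : (W.baseChange ℚ_[3]).toAffine.Point // (3 : ℕ) • Q = 0} = 1)
    (v₃ : HeightOneSpectrum (𝓞 ℚ)) (hv₃ : ((3 : ℕ) : 𝓞 ℚ) ∈ v₃.asIdeal)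
    (η : (q : HeightOneSpectrum (𝓞 ℚ)) → (ZMod (Ideal.absNorm q.asIdeal))ˣ)
    {N : ℕ} [NeZero N] (P : ModularParametrizationData W N) (hN : N = W.conductorNorm ℤ)
    (hlat : ∀ z ∈ P.L.lattice, ∃ w ∈ periodLattice P.f, z = P.c * w)
    (hman : ¬ (3 : ℤ) ∣ P.maninConstant)
    -- the row has NO anomalous bad place `w ≠ 3` (THEOREM D's `hbad`)
    (hbad : ∀ w : HeightOneSpectrum (𝓞 ℚ), ¬ W.HasGoodReductionAt w →
      ((primesEquiv w : Nat.Primes) : ℕ) ≠ 3 →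
        ∀ Q : (W.baseChange (w.adicCompletion ℚ)).toAffine.Point, 3 • Q = 0 → Q = 0) :
    KatoKuriharaPortThreeAtWith₂ W 0 v₃ η P := by
  haveI : Fact (Nat.Prime 3) := ⟨Nat.prime_three⟩
  haveI : ContinuousSMul ℤ_[3] (W.tateModule 3) := TateModule.continuousSMul_padicInt
  haveI : Module.Free ℤ_[3] (W.tateModule 3) := W.module_free_tateModule_holds 3
  haveI : Module.Finite ℤ_[3] (W.tateModule 3) := W.module_finite_tateModule_holds 3
  obtain ⟨c, d, a, A, d', aM, hA, hcA, hdN, hcdA, hcd, hdd', hAN, haM, hE0, hE, hR0, hR⟩ :=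
    hC2 W htow hadd hc3 ht P hN hlat hman
  haveI : NeZero A := ⟨hA.ne'⟩
  obtain ⟨ι, κK, Λ, Λfin, hκ0, hNorm, hfin, hz⟩ := hC1 W htow hadd hc3 ht v₃ hv₃ P hN hlat hman
  obtain ⟨z, x, hbody⟩ := hz c d a A hA hcA hdN
  have hirr : W.HasIrreducibleModPGaloisRep 3 := hasIrreducibleModPGaloisRep_three_of_tower W htow
  have hpN : 3 ^ 2 ∣ N := hN ▸ sq_dvd_conductorNorm_of_addv W hadd
  have ht0 : ∀ w : HeightOneSpectrum (𝓞 ℚ), ((3 : ℕ) : 𝓞 ℚ) ∈ w.asIdeal →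
      ∀ Q : (W.baseChange (w.adicCompletion ℚ)).toAffine.Point, 3 • Q = 0 → Q = 0 :=
    fun w hw => forall_torsion_three_eq_zero_adicCompletion_of_natCard_eq_one W ht w hw
  exact katoKuriharaPortThreeAtWith₂_zero_of_zetaBody_of_valueRows W P hN hbody Λfin hfin hcdA hbad
    ht0 hirr hNorm hκ0 d' hcd hdd' hAN hpN aM haM hE0 hE hR0 hR

/-! ### §3. The crux BY NAME from (C1) + (C2) + (C3) -/

/-- **Crux `KatoKuriharaPortThreeShared` (stmt-BirchSwinnertonDyer-19560) BY NAME from the three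
displayed residual inputs**: (C1) the fine Kato package (Kato's `ZetaBody` family for `P.f` — the
conclusion of the PUBLISHED fact `Kato2004.exists_eulerSystem_expStar_values` — WITH the
finite-level dual-exponential riders `KatoExpStarFiniteLevelAt` at every depth and the
`ω`-normalisation of Kato's constant), (C2) the per-row supply of Kato's auxiliary cusp datum with
unit value certificates, (C3) the crux restricted to the rows having an anomalous bad place
`w ≠ 3` (`E(ℚ_w)[3] ≠ 0`).  Proof: split a row on the existence of an anomalous bad place; use
(C3) there and `portShared_row_of_fineKato_of_certSupply_of_noAnomalous` elsewhere.  Nothing is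
booked; 19560 stays open until (C1)–(C3) are discharged (kim3 memo KIM3-W2-PORT-g10.md).
[cite: Kato2004Asterisque, (8.1.3) (p. 180), Prop. 8.12 (p. 186), §9.4 and Thm. 9.7 (pp. 188–189), Thm. 6.6 (1) (p. 163), Ex. 13.3 (pp. 224–225)]
[cite: Kim2022StructureSelmer, Thm. 3.13 and §3.3–§3.4.1] [cite: MazurRubin2004, Thm. 3.2.4 and App. A]
[cite: Rubin2000, Thm. 4.5.1] -/
theorem katoKuriharaPortThreeShared_of_fineKato_of_certSupply_of_anomalousRows
    (hC1 : ∀ (W : WeierstrassCurve ℚ) [W.IsElliptic] [W.IsGloballyMinimal]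
      [ContinuousSMul ℤ_[3] (W.tateModule 3)] [Module.Free ℤ_[3] (W.tateModule 3)]
      [Module.Finite ℤ_[3] (W.tateModule 3)],
      (∀ m : ℕ, W.HasSurjectiveModNGaloisRep (3 ^ m : ℕ)) →
      (haveI : Fact (Nat.Prime 3) := ⟨Nat.prime_three⟩; Addv W 3) →
      ¬ 3 ∣ (W.baseChange ℚ_[3]).localTamagawaNumber ℤ_[3] →
      Nat.card {Q : (W.baseChange ℚ_[3]).toAffine.Point // (3 : ℕ) • Q = 0} = 1 →
      ∀ (v₃ : HeightOneSpectrum (𝓞 ℚ)), ((3 : ℕ) : 𝓞 ℚ) ∈ v₃.asIdeal →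
      ∀ {N : ℕ} [NeZero N] (P : ModularParametrizationData W N), N = W.conductorNorm ℤ →
        (∀ z ∈ P.L.lattice, ∃ w ∈ periodLattice P.f, z = P.c * w) →
        ¬ (3 : ℤ) ∣ P.maninConstant →
        ∃ (ι : (n : ℕ) → (CyclotomicField n ℚ →+* ℂ)) (κK : ℝ)
          (Λ : ∀ (k' : ℕ) (r : Finset (HeightOneSpectrum (𝓞 ℚ))),
            H1 (tateRep W 3) (cycSubgroup 3 k' r) →ₗ[ℤ_[3]]
              ℚ_[3] ⊗[ℚ] CyclotomicField (cycLevel 3 k' r) ℚ)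
          (Λfin : ∀ j : ℕ, galoisCohomology
            ((W.torsionGaloisModule (((3 : ℕ) : ℤ) ^ j * ((3 : ℕ) : ℤ))).toLocal (Sum.inr v₃)) 1 →+
              ZMod (3 ^ (j + 1))),
          κK ≠ 0 ∧ (∃ u : ℚ, (u : ℝ) = κK ∧ padicValRat 3 u = 0) ∧
          (∀ j : ℕ, KatoExpStarFiniteLevelAt W 3 j 0 v₃ Λ (Λfin j)) ∧
          ∀ (c d a : ℤ) (A : ℕ), 0 < A → Int.gcd c (6 * 3 * A) = 1 → Int.gcd d (6 * 3 * N) = 1 →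
            ∃ (z : ∀ (k' : ℕ) (r : (cyclotomicLevelsRat 3 (badPlaces c d A N)).Ideals),
                  H1 (tateRep W 3) ((cyclotomicLevelsRat 3 (badPlaces c d A N)).level k' r.1))
              (x : ∀ (k' : ℕ) (r : (cyclotomicLevelsRat 3 (badPlaces c d A N)).Ideals),
                  CyclotomicField (cycLevel 3 k' r.1) ℚ),
              ZetaBody W 3 P.f ι κK Λ c d a A z x)
    (hC2 : ∀ (W : WeierstrassCurve ℚ) [W.IsElliptic] [W.IsGloballyMinimal],
      (∀ m : ℕ, W.HasSurjectiveModNGaloisRep (3 ^ m : ℕ)) →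
      (haveI : Fact (Nat.Prime 3) := ⟨Nat.prime_three⟩; Addv W 3) →
      ¬ 3 ∣ (W.baseChange ℚ_[3]).localTamagawaNumber ℤ_[3] →
      Nat.card {Q : (W.baseChange ℚ_[3]).toAffine.Point // (3 : ℕ) • Q = 0} = 1 →
      ∀ {N : ℕ} [NeZero N] (P : ModularParametrizationData W N), N = W.conductorNorm ℤ →
        (∀ z ∈ P.L.lattice, ∃ w ∈ periodLattice P.f, z = P.c * w) →
        ¬ (3 : ℤ) ∣ P.maninConstant →
        ∃ (c d a : ℤ) (A : ℕ) (d' : ℤ) (aM : ℕ → ℤ),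
          0 < A ∧ Int.gcd c (6 * 3 * A) = 1 ∧ Int.gcd d (6 * 3 * N) = 1 ∧
          (∀ q : ℕ, q.Prime → q ≡ 1 [MOD 3] → ¬ q ∣ 2 * c.natAbs * d.natAbs * A) ∧
          Int.gcd (c * d) A = 1 ∧ d * d' ≡ 1 [ZMOD (A : ℤ)] ∧ Nat.Coprime A N ∧
          (∀ q ∈ (3 * A).primeFactors, cuspCoeff P.f q = aM q) ∧
          (∏ q ∈ (3 * A).primeFactors,
              (1 - (aM q : ℚ) / q + (if q ∣ N then 0 else (1 / q : ℚ))) ≠ 0) ∧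
          padicValRat 3 (∏ q ∈ (3 * A).primeFactors,
              (1 - (aM q : ℚ) / q + (if q ∣ N then 0 else (1 / q : ℚ)))) = 0 ∧
          ((c : ℚ) ^ 2 * (d : ℚ) ^ 2 * ratMinusSymbol P.f ((a : ℚ) / A) -
              (c : ℚ) * (d : ℚ) ^ 2 * ratMinusSymbol P.f ((a * c : ℚ) / A) -
              (c : ℚ) ^ 2 * (d : ℚ) * ratMinusSymbol P.f ((a * d' : ℚ) / A) +
              (c : ℚ) * (d : ℚ) * ratMinusSymbol P.f ((a * c * d' : ℚ) / A) ≠ 0) ∧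
          padicValRat 3 ((c : ℚ) ^ 2 * (d : ℚ) ^ 2 * ratMinusSymbol P.f ((a : ℚ) / A) -
              (c : ℚ) * (d : ℚ) ^ 2 * ratMinusSymbol P.f ((a * c : ℚ) / A) -
              (c : ℚ) ^ 2 * (d : ℚ) * ratMinusSymbol P.f ((a * d' : ℚ) / A) +
              (c : ℚ) * (d : ℚ) * ratMinusSymbol P.f ((a * c * d' : ℚ) / A)) = 0)
    (hC3 : ∀ (W : WeierstrassCurve ℚ) [W.IsElliptic] [W.IsGloballyMinimal],
      (∀ m : ℕ, W.HasSurjectiveModNGaloisRep (3 ^ m : ℕ)) →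
      (haveI : Fact (Nat.Prime 3) := ⟨Nat.prime_three⟩; Addv W 3) →
      ¬ 3 ∣ (W.baseChange ℚ_[3]).localTamagawaNumber ℤ_[3] →
      Nat.card {Q : (W.baseChange ℚ_[3]).toAffine.Point // (3 : ℕ) • Q = 0} = 1 →
      ∀ (v₃ : HeightOneSpectrum (𝓞 ℚ)), ((3 : ℕ) : 𝓞 ℚ) ∈ v₃.asIdeal →
      ∀ (η : (q : HeightOneSpectrum (𝓞 ℚ)) → (ZMod (Ideal.absNorm q.asIdeal))ˣ),
        (∀ q, Subgroup.zpowers (η q) = ⊤) →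
      ∀ {N : ℕ} [NeZero N] (P : ModularParametrizationData W N), N = W.conductorNorm ℤ →
        (∀ z ∈ P.L.lattice, ∃ w ∈ periodLattice P.f, z = P.c * w) →
        ¬ (3 : ℤ) ∣ P.maninConstant →
        -- the row HAS an anomalous bad place `w ≠ 3`
        (∃ w : HeightOneSpectrum (𝓞 ℚ), ¬ W.HasGoodReductionAt w ∧
          ((primesEquiv w : Nat.Primes) : ℕ) ≠ 3 ∧
          ∃ Q : (W.baseChange (w.adicCompletion ℚ)).toAffine.Point, 3 • Q = 0 ∧ Q ≠ 0) →
        KatoKuriharaPortThreeAtWith₂ W 0 v₃ η P) :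
    Summit.BirchSwinnertonDyer.BirchSwinnertonDyer.Theses.KimAtThreeKolyvagin.KatoKuriharaPortThreeShared := by
  intro W _ _ htow hadd hc3 ht v₃ hv₃ η hη N _ P hN hlat hman
  by_cases hanom : ∃ w : HeightOneSpectrum (𝓞 ℚ), ¬ W.HasGoodReductionAt w ∧
      ((primesEquiv w : Nat.Primes) : ℕ) ≠ 3 ∧
      ∃ Q : (W.baseChange (w.adicCompletion ℚ)).toAffine.Point, 3 • Q = 0 ∧ Q ≠ 0
  · exact hC3 W htow hadd hc3 ht v₃ hv₃ η hη P hN hlat hman hanom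
  · push Not at hanom
    exact portShared_row_of_fineKato_of_certSupply_of_noAnomalous hC1 hC2 W htow hadd hc3 ht v₃ hv₃
      η P hN hlat hman hanom

end Summit.BirchSwinnertonDyer.BirchSwinnertonDyer.Theorems.KimAtThreeKolyvaginPortShared

end
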